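import Mathlib
import Literature.MathematicalPhysics.QuantumFieldTheory.Balaban1983to89.B12Ineq45

/-!
# Bałaban, *Renormalization group approach to lattice gauge field theories. I* (CMP 109, 1987), §4 p. 281:
# the identity (4.3) KERNEL-CHECKED (Faà di Bruno), and (4.5) from function-level hypotheses

Source reproduced (statement level + kernel bookkeeping; nothing of the series is asserted):

* T. Bałaban, *Renormalization group approach to lattice gauge field theories. I. Generation of effective actions in
  a small field approximation and a coupling constant renormalization in four dimensions*, Commun. Math. Phys.
  **109** (1987) 249–301 [`Balaban1987RG1`; renders `b2b-balaban-ref1/pages/1987-cmp109-rg-I-small-field/…-p033-x2.png`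
  (p. 281), `…-p034-x2.png` (p. 282) read for this module; the displays (4.2)–(4.5), (4.4) and the p. 282 sentences are
  quoted in full in the header of `…Balaban1983to89.B12Ineq45`, which this module continues].

  p. 281 [PDF 33], verbatim (the step certified here): *"Differentiating the composite function on the right-hand
  side above n times with respect to B, we obtain the identities
  ⟨δⁿ/δBⁿ 𝐄^{(j)}(X, U_j(□₀, 1)), ⊗_{i=1}^n B_i⟩
   = Σ_{{1,…,n}=N(1)∪…∪N(r)} ⟨δʳ/δ𝐇ʳ 𝐄^{(j)}(X, 1), ⊗_{p=1}^r ⟨δ^{n(p)}/δB^{n(p)} 𝐇_j(□₀, 0), ⊗_{i∈N(p)} B_i⟩⟩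
   = Σ ∂ʳ/(∂τ₁…∂τ_r) 𝐄^{(j)}(X, exp iξ Σ_{p=1}^r τ_p ⟨δ^{n(p)}/δB^{n(p)} 𝐇_j(□₀, 0), ⊗_{i∈N(p)} B_i⟩)|_{τ=0}
   = …  (4.3)"* — the composite function being `B ↦ 𝐄^{(j)}(X, exp iξ𝐇_j(□₀, B))` ((4.2)), the outer function
  `𝐇 ↦ 𝐄^{(j)}(X, exp iξ𝐇)` *"defined and analytic on the space of configurations … (4.4)"*, and the inner value at
  `B = 0` being `𝐇_j(□₀, 0) = 0` (the display evaluates the outer derivative at *"𝐄^{(j)}(X, 1)"*, `1 = exp iξ·0`).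

  p. 282 [PDF 34], verbatim (the per-block input, hypotheses `hv` / `hvloc` below): *"The norm in (4.4) of the
  expression ⟨δ^{n(p)}/δB^{n(p)} 𝐇_j(□₀, 0), ⊗_{i∈N(p)} B_i⟩ can be estimated by B₃ Π_{i∈N(p)} |B_i|, and if one of the
  functions B_i is localized outside the domain X, then we have the additional exponential factor
  exp(−δ₀ dist^{(ξ)}(X, supp B_i))."*

WHAT THIS MODULE DOES (surge unit `b2b-balaban-pv12`, gen 2, node `G-IF-07-REPR43-KERNEL`, 2026-08-18; imports
`Mathlib` and `…Balaban1983to89.B12Ineq45` only; modifies nothing; cell rows GAPS C-pv12-4 (leaf (i) "the identity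
(4.3)" is discharged here), C-pv12-5, DIVERGENCE D-pv12.6):

1. `faaDiBruno_apply` — THE FIRST EQUALITY OF (4.3) for maps `H : W → E`, `f : E → F` between normed spaces over any
   field, `C^N` at the point: `Dⁿ(f ∘ H)(x)[B_1,…,B_n] = Σ_c D^{r}f(H x)[v_1,…,v_r]`, the sum over the set partitions
   `c` of `{1,…,n}` into blocks `N(1),…,N(r)` (Mathlib's `OrderedFinpartition n`: blocks listed increasingly, ordered by
   their last element — one representative per set partition), `v_p = D^{n(p)}H(x)[B_i : i ∈ N(p)]` (`blockIns`).  It is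
   Mathlib's Faà di Bruno formula `iteratedFDeriv_comp` (`FormalMultilinearSeries.taylorComp`) unfolded; nothing else.
2. `card_orderedFinpartition_le_factorial` / `_le_pow` — the number of terms: `#OrderedFinpartition n ≤ n! ≤ nⁿ`
   (from Mathlib's `OrderedFinpartition.extendEquiv`: a partition of `n+1` points is a partition of `n` points plus the
   position of the new point), the count used for the constant of (4.5) in `B12Ineq45.sum_bound`.
3. `dirIter_eq_iteratedFDeriv` — THE SECOND EQUALITY OF (4.3): for `f` `C^r` on an open set, the `r`-fold directional
   derivative `∂_{v_r}⋯∂_{v_1}f(x)` of `B12Ineq45.dirIter` (there identified with the `τ`-derivatives at `0` of the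
   complex-line slices, `dirIter_succ_eqOn_slice`) IS `D^r f(x)[v_r,…,v_1]`; hence the iterated Cauchy estimate of
   `B12Ineq45` in Mathlib's language: `norm_iteratedFDeriv_apply_le_of_ball`.
4. `norm_iteratedFDeriv_comp_le` — (4.3) ⇒ the bound of (4.5) FROM FUNCTION-LEVEL HYPOTHESES ONLY: outer `f` analytic
   on an open `U ⊇ {‖𝐇‖ < α₂}` with `‖f‖ ≤ S` there ((4.4) + (1.18)), inner `H` `Cⁿ` at `0` with `H 0 = 0`, the p. 282
   sentence for the blocks that occur (`hv`: `‖v_p‖ ≤ B₃ Π_{i∈N(p)} ‖B_i‖`; `hvloc`: an extra factor `W₀ ∈ [0,1]` when the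
   block contains an argument localised outside `X`), at least one outside-localised argument, `2B₃ ≥ α₂` ⇒
   `‖Dⁿ(f∘H)(0)[B_1,…,B_n]‖ ≤ (2n²B₃/α₂)ⁿ · S · W₀ · Π_i ‖B_i‖`; and `ineq45_of_functions : … → B12Ineq45.Ineq45Printed D`
   — the display (4.5) with `lhs = ‖Dⁿ(f∘H)(0)[ζ̃_□B ×m, (1−ζ̃_□)B ×(n−m)]‖`, discharging the hypotheses `hlhs`, `term`,
   `hterm` of `B12Ineq45.ineq45_of_repr43`.
Remaining named leaves after this module: analyticity of `𝐀 ↦ 𝐄^{(j)}(X, exp iξ𝐀)` on (4.4) with the sup (1.18)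
(`hf`, `hball`, `hS`); differentiability of `B ↦ 𝐇_j(□₀, B)` at `0` and `𝐇_j(□₀, 0) = 0` (`hH`, `hH0`; [15]); the
p. 282 block bounds (`hv`, `hvloc`: for `n(p) = 1` see `B12Ineq45.loc_dH_le_of_ineq190(_localised)` from the tree's
(190); for `n(p) ≥ 2` the tree-graph decay of [15] Sect. G, cell GAPS G-B11-G2a); the identification of |B_i| and of
the (4.4)-functional with norms of abstract complex normed spaces `W`, `E` (cell DIVERGENCE D-pv12.3, D-pv12.6).
Value = kernel-checked derivation of a located by-reference step ("differentiating the composite function … n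
times"), NOT summit progress.
-/

noncomputable section

open Set Metric Filter Finset
open scoped Topology BigOperators

namespace Literature.MathematicalPhysics.QuantumFieldTheory.Balaban1983to89.B12Repr43

open B12Ineq45

/-! ## The first equality of (4.3): Faà di Bruno over the set partitions of `{1,…,n}` -/

section FaaDiBruno

variable {𝕜 : Type*} [NontriviallyNormedField 𝕜]
  {W : Type*} [NormedAddCommGroup W] [NormedSpace 𝕜 W]
  {E : Type*} [NormedAddCommGroup E] [NormedSpace 𝕜 E]
  {F : Type*} [NormedAddCommGroup F] [NormedSpace 𝕜 F]

/-- The insertion of the block `N(p)` of the partition `c`: `v_p = ⟨δ^{n(p)}/δB^{n(p)} 𝐇(x), ⊗_{i∈N(p)} B_i⟩ =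
D^{n(p)}H(x)[B_i : i ∈ N(p)]` (arguments in increasing order of `i`). [cite: Balaban1987RG1, (4.3) p.281] -/
def blockIns (H : W → E) (x : W) {n : ℕ} (B : Fin n → W) (c : OrderedFinpartition n) : Fin c.length → E :=
  fun p => iteratedFDeriv 𝕜 (c.partSize p) H x (B ∘ c.emb p)

/-- **(4.3), first equality** (*"Differentiating the composite function … n times with respect to B, we obtain
the identities"*): `Dⁿ(f ∘ H)(x)[B_1,…,B_n] = Σ_{c} D^{r(c)} f(H x)[v_1,…,v_{r(c)}]`, `c` over the set partitions of
`{1,…,n}` (`OrderedFinpartition n`), `v_p` the block insertions (`blockIns`).  Mathlib's Faà di Bruno formula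
`iteratedFDeriv_comp` (`FormalMultilinearSeries.taylorComp`) unfolded. [cite: Balaban1987RG1, (4.3) p.281] -/
theorem faaDiBruno_apply {H : W → E} {f : E → F} {x : W} {N : WithTop ℕ∞} (hf : ContDiffAt 𝕜 N f (H x))
    (hH : ContDiffAt 𝕜 N H x) {n : ℕ} (hn : (n : WithTop ℕ∞) ≤ N) (B : Fin n → W) :
    iteratedFDeriv 𝕜 n (f ∘ H) x B =
      ∑ c : OrderedFinpartition n, iteratedFDeriv 𝕜 c.length f (H x) (blockIns (𝕜 := 𝕜) H x B c) := by
  rw [iteratedFDeriv_comp hf hH hn]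
  simp only [FormalMultilinearSeries.taylorComp, _root_.sum_apply,
    FormalMultilinearSeries.compAlongOrderedFinpartition_apply, OrderedFinpartition.applyOrderedFinpartition_apply]
  rfl

/-- The number of set partitions of `n + 1` points, counted through Mathlib's `extendEquiv` (a partition of `n`
points plus the place of the new point: a new singleton, or one of the `r` blocks). [folklore] -/
theorem card_orderedFinpartition_succ (n : ℕ) :
    Fintype.card (OrderedFinpartition (n + 1)) = ∑ c : OrderedFinpartition n, (c.length + 1) := by
  rw [← Fintype.card_congr (OrderedFinpartition.extendEquiv n), Fintype.card_sigma]
  simp [Fintype.card_option]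

/-- The number of terms of (4.3): at most `n!` set partitions of `{1,…,n}` (each block count `r ≤ n`).
[folklore] -/
theorem card_orderedFinpartition_le_factorial : ∀ n : ℕ, Fintype.card (OrderedFinpartition n) ≤ n.factorial
  | 0 => by simp
  | n + 1 => by
    rw [card_orderedFinpartition_succ, Nat.factorial_succ]
    calc ∑ c : OrderedFinpartition n, (c.length + 1) ≤ ∑ _c : OrderedFinpartition n, (n + 1) :=
          Finset.sum_le_sum fun c _ => Nat.succ_le_succ c.length_le
      _ = Fintype.card (OrderedFinpartition n) * (n + 1) := by
          rw [Finset.sum_const, Finset.card_univ, smul_eq_mul]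
      _ ≤ n.factorial * (n + 1) := Nat.mul_le_mul_right _ (card_orderedFinpartition_le_factorial n)
      _ = (n + 1) * n.factorial := Nat.mul_comm _ _

/-- The count used in (4.5): at most `nⁿ` terms in (4.3) (`B12Ineq45.sum_bound`). [cite: Balaban1987RG1, (4.5) p.282] -/
theorem card_orderedFinpartition_le_pow (n : ℕ) : Fintype.card (OrderedFinpartition n) ≤ n ^ n :=
  (card_orderedFinpartition_le_factorial n).trans (Nat.factorial_le_pow n)

/-- The block `N(p)` of `c` as a finite set of argument positions. [folklore] -/
def blockSet {n : ℕ} (c : OrderedFinpartition n) (p : Fin c.length) : Finset (Fin n) :=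
  Finset.univ.image (c.emb p)

/-- Distinct blocks are disjoint. [folklore] -/
theorem disjoint_blockSet {n : ℕ} (c : OrderedFinpartition n) {p q : Fin c.length} (hpq : p ≠ q) :
    Disjoint (blockSet c p) (blockSet c q) := by
  rw [← Finset.disjoint_coe]
  simp only [blockSet, Finset.coe_image, Finset.coe_univ, Set.image_univ]
  exact c.disjoint (Set.mem_univ p) (Set.mem_univ q) hpq

/-- Every argument position lies in the block of its index. [folklore] -/
theorem mem_blockSet_index {n : ℕ} (c : OrderedFinpartition n) (i : Fin n) : i ∈ blockSet c (c.index i) :=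
  Finset.mem_image.2 ⟨c.invEmbedding i, Finset.mem_univ _, c.emb_invEmbedding i⟩

/-- The blocks cover `{1,…,n}` (any reindexing of the blocks by a bijection). [folklore] -/
theorem biUnion_blockSet_comp_equiv {n : ℕ} (c : OrderedFinpartition n) (σ : Fin c.length ≃ Fin c.length) :
    Finset.univ.biUnion (fun p => blockSet c (σ p)) = Finset.univ := by
  refine Finset.eq_univ_iff_forall.2 fun i => Finset.mem_biUnion.2 ⟨σ.symm (c.index i), Finset.mem_univ _, ?_⟩
  rw [Equiv.apply_symm_apply]
  exact mem_blockSet_index c i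

/-- A product over the block `N(p)` is the product over its increasing parameterisation. [folklore] -/
theorem prod_blockSet {n : ℕ} (c : OrderedFinpartition n) (p : Fin c.length) (b : Fin n → ℝ) :
    ∏ i ∈ blockSet c p, b i = ∏ q, b (c.emb p q) := by
  rw [blockSet, Finset.prod_image]
  exact fun q _ q' _ h => (c.emb_strictMono p).injective h

end FaaDiBruno

/-! ## The second equality of (4.3): the terms are iterated directional derivatives -/

section Directional

variable {E : Type*} [NormedAddCommGroup E] [NormedSpace ℂ E]
  {F : Type*} [NormedAddCommGroup F] [NormedSpace ℂ F]

/-- **(4.3), second equality**: for `f` of class `C^r` on an open set `U ∋ x`, the iterated directional derivative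
`∂_{v_{r}} ⋯ ∂_{v_1} f(x)` (`B12Ineq45.dirIter`, differentiate first along `v_1 = v 0`; on the domain of holomorphy
these are the `τ`-derivatives at `0` of the second member of (4.3), `B12Ineq45.dirIter_succ_eqOn_slice`) equals the
`r`-th Fréchet derivative `D^r f(x)[v_r, …, v_1]` (Mathlib's `iteratedFDeriv`, whose LAST argument is the innermost
direction). [cite: Balaban1987RG1, (4.3) p.281] -/
theorem dirIter_eq_iteratedFDeriv {U : Set E} (hU : IsOpen U) (r : ℕ) :
    ∀ (v : Fin r → E) (f : E → F), ContDiffOn ℂ r f U → ∀ x ∈ U,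
      dirIter r v f x = iteratedFDeriv ℂ r f x (fun i => v (Fin.rev i)) := by
  induction r with
  | zero => intro v f _ x _; simp
  | succ r ih =>
    intro v f hf x hx
    have hf1 : ContDiffOn ℂ r (fun y => fderiv ℂ f y) U := hf.fderiv_of_isOpen hU (by norm_cast)
    have hg : ContDiffOn ℂ r (fun y => fderiv ℂ f y (v 0)) U := hf1.clm_apply contDiffOn_const
    rw [dirIter_succ, ih (Fin.tail v) _ hg x hx, iteratedFDeriv_succ_apply_right]
    have hlast : v (Fin.rev (Fin.last r)) = v 0 := by
      rw [Fin.rev_last]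
    have hinit : Fin.init (fun i : Fin (r + 1) => v (Fin.rev i)) = fun i : Fin r => Fin.tail v (Fin.rev i) := by
      funext i
      simp [Fin.init, Fin.tail, Fin.rev_castSucc]
    rw [hlast, hinit]
    have hcomp := ContinuousLinearMap.iteratedFDeriv_comp_left (ContinuousLinearMap.apply ℂ F (v 0))
      (f := fun y => fderiv ℂ f y) (hf1.contDiffAt (hU.mem_nhds hx)) (i := r) le_rfl
    have hfun : (fun y => fderiv ℂ f y (v 0)) = (ContinuousLinearMap.apply ℂ F (v 0)) ∘ fun y => fderiv ℂ f y := by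
      funext y; rfl
    rw [hfun, hcomp]
    rfl

/-- The same with the directions listed in Mathlib's order: `D^r f(x)[v] = ∂_{v_1} ⋯ ∂_{v_r} f(x)` computed by
`dirIter` on the reversed list. [cite: Balaban1987RG1, (4.3) p.281] -/
theorem iteratedFDeriv_apply_eq_dirIter {U : Set E} (hU : IsOpen U) {r : ℕ} {f : E → F} (hf : ContDiffOn ℂ r f U)
    {x : E} (hx : x ∈ U) (v : Fin r → E) :
    iteratedFDeriv ℂ r f x v = dirIter r (fun p => v (Fin.rev p)) f x := by
  rw [dirIter_eq_iteratedFDeriv hU r _ f hf x hx]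
  simp [Fin.rev_rev]

variable [CompleteSpace F]

/-- **Iterated Cauchy estimate, Mathlib form** (`B12Ineq45.norm_dirIter_le_of_ball'` transported by the second
equality of (4.3)): `f` analytic on an open `U ⊇ {‖y‖ < α}`, `‖f‖ ≤ S` on that ball, `‖v_p‖ ≤ β_p` ⇒
`‖D^r f(0)[v_1,…,v_r]‖ ≤ S (2r/α)^r Π_p β_p`. [cite: Balaban1987RG1, (4.3)–(4.5) pp.281–282] -/
theorem norm_iteratedFDeriv_apply_le_of_ball {U : Set E} (hU : IsOpen U) {α S : ℝ} (hα : 0 < α)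
    (hball : ball (0 : E) α ⊆ U) {f : E → F} (hf : AnalyticOnNhd ℂ f U) (hS : ∀ y ∈ ball (0 : E) α, ‖f y‖ ≤ S)
    {r : ℕ} (v : Fin r → E) (β : Fin r → ℝ) (hβ : ∀ p, 0 ≤ β p) (hv : ∀ p, ‖v p‖ ≤ β p) :
    ‖iteratedFDeriv ℂ r f 0 v‖ ≤ S * (2 * r / α) ^ r * ∏ p, β p := by
  have h0 : (0 : E) ∈ U := hball (mem_ball_self hα)
  rw [iteratedFDeriv_apply_eq_dirIter hU (hf.contDiffOn_of_completeSpace (n := r)) h0 v]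
  have h := norm_dirIter_le_of_ball' hU hα hball hf.differentiableOn hS (fun p => v (Fin.rev p))
    (fun p => β (Fin.rev p)) (fun p => hβ _) (fun p => hv _)
  have hprod : ∏ p : Fin r, β (Fin.rev p) = ∏ p, β p :=
    Fintype.prod_equiv Fin.revPerm _ _ fun p => rfl
  rw [hprod] at h
  exact h

end Directional

/-! ## (4.3) ⇒ (4.5) from function-level hypotheses -/

section Args

/-- The `n` arguments of (4.5): `m` copies of `ζ̃_□B`, then `n − m` copies of `(1−ζ̃_□)B`.
[cite: Balaban1987RG1, (4.5) p.282] -/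
def args45 {W : Type*} (n m : ℕ) (zB czB : W) : Fin n → W := fun i => if (i : ℕ) < m then zB else czB

/-- Their sizes multiply to `|ζ̃_□B|^m |(1−ζ̃_□)B|^{n−m}` (`B12Ineq45.prod_two_kinds`). [folklore] -/
theorem prod_norm_args45 {W : Type*} [NormedAddCommGroup W] {n m : ℕ} (hm : m ≤ n) (zB czB : W) :
    ∏ i, ‖args45 n m zB czB i‖ = ‖zB‖ ^ m * ‖czB‖ ^ (n - m) := by
  rw [← prod_two_kinds hm ‖zB‖ ‖czB‖]
  refine Finset.prod_congr rfl fun i _ => ?_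
  simp only [args45]
  split_ifs <;> rfl

end Args

section Bound

variable {W : Type*} [NormedAddCommGroup W] [NormedSpace ℂ W]
  {E : Type*} [NormedAddCommGroup E] [NormedSpace ℂ E]
  {F : Type*} [NormedAddCommGroup F] [NormedSpace ℂ F] [CompleteSpace F]

/-- (4.3) with each term written as an iterated directional derivative at `H 0 = 0` (both printed equalities):
`Dⁿ(f∘H)(0)[B] = Σ_c ∂_{v_{1}} ⋯ ∂_{v_{r}} f(0)`. [cite: Balaban1987RG1, (4.3) p.281] -/
theorem faaDiBruno_dirIter {U : Set E} (hU : IsOpen U) (h0 : (0 : E) ∈ U) {f : E → F} (hf : AnalyticOnNhd ℂ f U)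
    {H : W → E} {n : ℕ} (hH : ContDiffAt ℂ n H 0) (hH0 : H 0 = 0) (B : Fin n → W) :
    iteratedFDeriv ℂ n (f ∘ H) 0 B =
      ∑ c : OrderedFinpartition n, dirIter c.length (fun p => blockIns (𝕜 := ℂ) H 0 B c (Fin.rev p)) f 0 := by
  have hfc : ContDiffAt ℂ n f (H 0) := by
    rw [hH0]; exact (hf.contDiffOn_of_completeSpace (n := n)).contDiffAt (hU.mem_nhds h0)
  rw [faaDiBruno_apply hfc hH le_rfl B]
  refine Finset.sum_congr rfl fun c _ => ?_
  rw [hH0]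
  exact iteratedFDeriv_apply_eq_dirIter hU
    ((hf.contDiffOn_of_completeSpace (n := n)).of_le (by exact_mod_cast c.length_le)) h0 _

/-- **(4.3) + (4.4) + (1.18) + the p. 282 sentence ⇒ the bound of (4.5), from functions.**  Outer `f` (`𝐇 ↦
𝐄^{(j)}(X, exp iξ𝐇)`) analytic on an open `U ⊇ {‖𝐇‖ < α₂}` with `‖f‖ ≤ S` there; inner `H` (`B ↦ 𝐇_j(□₀, B)`) `Cⁿ` at
`0` with `H 0 = 0`; arguments `B_1, …, B_n`, a set `out` of positions whose argument is localised outside `X`,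
containing `i₀`; the p. 282 bounds for the blocks `N(p)` of every partition: `‖v_p‖ ≤ B₃ Π_{i∈N(p)} ‖B_i‖` (`hv`), and
`≤ W₀ · B₃ Π_{i∈N(p)} ‖B_i‖` with `W₀ ∈ [0,1]` (`= exp(−δ₀ dist^{(ξ)}(X, supp B_i))`) if `N(p)` meets `out` (`hvloc`);
`2B₃ ≥ α₂`.  Then `‖Dⁿ(f∘H)(0)[B_1,…,B_n]‖ ≤ (2n²B₃/α₂)ⁿ · S · W₀ · Π_i ‖B_i‖`: (4.3) (`faaDiBruno_dirIter`), one
Cauchy estimate per term keeping the weight of the block of `i₀` (`B12Ineq45.term_bound`), at most `nⁿ` terms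
(`card_orderedFinpartition_le_pow`, `B12Ineq45.sum_bound`). [cite: Balaban1987RG1, (4.3)–(4.5) pp.281–282] -/
theorem norm_iteratedFDeriv_comp_le {U : Set E} (hU : IsOpen U) {α₂ S B₃ W₀ : ℝ} (hα : 0 < α₂)
    (hball : ball (0 : E) α₂ ⊆ U) {f : E → F} (hf : AnalyticOnNhd ℂ f U) (hS : ∀ y ∈ ball (0 : E) α₂, ‖f y‖ ≤ S)
    (hB : α₂ ≤ 2 * B₃) (hW0 : 0 ≤ W₀) (hW1 : W₀ ≤ 1)
    {H : W → E} {n : ℕ} (hH : ContDiffAt ℂ n H 0) (hH0 : H 0 = 0) (B : Fin n → W)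
    (out : Fin n → Prop) (i₀ : Fin n) (hi₀ : out i₀)
    (hv : ∀ (c : OrderedFinpartition n) (p : Fin c.length),
      ‖blockIns (𝕜 := ℂ) H 0 B c p‖ ≤ B₃ * ∏ q, ‖B (c.emb p q)‖)
    (hvloc : ∀ (c : OrderedFinpartition n) (p : Fin c.length), (∃ q, out (c.emb p q)) →
      ‖blockIns (𝕜 := ℂ) H 0 B c p‖ ≤ W₀ * (B₃ * ∏ q, ‖B (c.emb p q)‖)) :
    ‖iteratedFDeriv ℂ n (f ∘ H) 0 B‖ ≤ (2 * (n : ℝ) ^ 2 * B₃ / α₂) ^ n * S * W₀ * ∏ i, ‖B i‖ := by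
  classical
  have h0 : (0 : E) ∈ U := hball (mem_ball_self hα)
  have hS0 : 0 ≤ S := (norm_nonneg _).trans (hS 0 (mem_ball_self hα))
  have hB₃ : 0 ≤ B₃ := by linarith
  have hn : 0 < n := i₀.pos
  rw [faaDiBruno_dirIter hU h0 hf hH hH0 B]
  -- the localisation weight of a block: `W₀` if it meets `out`, else `1`
  set wt : (c : OrderedFinpartition n) → Fin c.length → ℝ :=
    fun c p => if ∃ q, out (c.emb p q) then W₀ else 1 with hwt
  have hwt0 : ∀ c p, 0 ≤ wt c p := fun c p => by
    simp only [hwt]; split_ifs <;> [exact hW0; exact zero_le_one]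
  have hwt1 : ∀ c p, wt c p ≤ 1 := fun c p => by
    simp only [hwt]; split_ifs <;> [exact hW1; exact le_rfl]
  have hins : ∀ (c : OrderedFinpartition n) (p : Fin c.length),
      ‖blockIns (𝕜 := ℂ) H 0 B c p‖ ≤ wt c p * (B₃ * ∏ i ∈ blockSet c p, ‖B i‖) := fun c p => by
    rw [prod_blockSet c p fun i => ‖B i‖]
    simp only [hwt]
    split_ifs with h
    · exact hvloc c p h
    · rw [one_mul]; exact hv c p
  have key : ∀ c ∈ (Finset.univ : Finset (OrderedFinpartition n)),
      ‖dirIter c.length (fun p => blockIns (𝕜 := ℂ) H 0 B c (Fin.rev p)) f 0‖ ≤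
        S * (2 * (c.length : ℝ) * B₃ / α₂) ^ c.length * W₀ * ∏ i, ‖B i‖ := by
    intro c _
    have h := term_bound (ι := Fin n) hU hα hball hf.differentiableOn hS hB₃
      (fun p => blockSet c (Fin.rev p))
      (fun p q hpq => disjoint_blockSet c fun h => hpq (Fin.rev_injective h))
      (biUnion_blockSet_comp_equiv c Fin.revPerm) (fun i => ‖B i‖) (fun i => norm_nonneg _)
      (fun p => wt c (Fin.rev p)) (fun p => hwt0 c _) (fun p => hwt1 c _)
      (fun p => blockIns (𝕜 := ℂ) H 0 B c (Fin.rev p)) (fun p => hins c _) (Fin.rev (c.index i₀))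
    have hw : wt c (Fin.rev (Fin.rev (c.index i₀))) = W₀ := by
      rw [Fin.rev_rev]
      simp only [hwt]
      rw [if_pos ⟨c.invEmbedding i₀, by rw [c.emb_invEmbedding]; exact hi₀⟩]
    rw [hw] at h
    exact h
  have hcount : (Finset.univ : Finset (OrderedFinpartition n)).card ≤ n ^ n := by
    rw [Finset.card_univ]; exact card_orderedFinpartition_le_pow n
  exact sum_bound (Finset.univ : Finset (OrderedFinpartition n)) n hcount (fun c => c.length)
    (fun c _ => c.length_pos hn) (fun c _ => c.length_le) hS0 hα hB hW0
    (Finset.prod_nonneg fun i _ => norm_nonneg _) _ key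

/-- **(4.5) from functions.**  With the printed numbers `D : B12Ineq45.Data45` whose left-hand side IS the norm of the
`n`-th derivative at `B = 0` of the composite `B ↦ f(H B)` = `𝐄^{(j)}(X, exp iξ𝐇_j(□₀, B))` ((4.2)) on the arguments
`ζ̃_□B` (`m` times) and `(1−ζ̃_□)B` (`n − m` times), and whose norms are `‖ζ̃_□B‖`, `‖(1−ζ̃_□)B‖`: the analyticity of
`f` on an open `U ⊇ {‖𝐇‖ < α₂}` ((4.4)) with `‖f‖ ≤ E₀e^{−κd_j(X)}` there ((1.18)), `H` `Cⁿ` at `0` with `H 0 = 0`,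
the p. 282 block bounds (`hv`; `hvloc` with the factor `exp(−δ₀ dist^{(ξ)}(X, supp(1−ζ̃_□)))` for the blocks
containing one of the last `n − m` arguments), `δ₀ dist ≥ 0` and `2B₃ ≥ α₂` imply the display (4.5)
(`B12Ineq45.Ineq45Printed D`) — i.e. the hypotheses `hlhs`, `term`, `hterm` of `B12Ineq45.ineq45_of_repr43` are
discharged by (4.3). [cite: Balaban1987RG1, (4.2)–(4.5) pp.281–282, (1.18) p.263] -/
theorem ineq45_of_functions (D : Data45) {U : Set E} (hU : IsOpen U) (hα : 0 < D.α₂)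
    (hball : ball (0 : E) D.α₂ ⊆ U) {f : E → F} (hf : AnalyticOnNhd ℂ f U)
    (hS : ∀ y ∈ ball (0 : E) D.α₂, ‖f y‖ ≤ D.E₀ * Real.exp (-(D.κ * D.djX)))
    (hB : D.α₂ ≤ 2 * D.B₃) (hδ : 0 ≤ D.δ₀ * D.distX)
    {H : W → E} (hH : ContDiffAt ℂ D.n H 0) (hH0 : H 0 = 0) (zB czB : W)
    (hz : D.normZB = ‖zB‖) (hcz : D.normCZB = ‖czB‖)
    (hlhs : D.lhs = ‖iteratedFDeriv ℂ D.n (f ∘ H) 0 (args45 D.n D.m zB czB)‖)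
    (hv : ∀ (c : OrderedFinpartition D.n) (p : Fin c.length),
      ‖blockIns (𝕜 := ℂ) H 0 (args45 D.n D.m zB czB) c p‖ ≤ D.B₃ * ∏ q, ‖args45 D.n D.m zB czB (c.emb p q)‖)
    (hvloc : ∀ (c : OrderedFinpartition D.n) (p : Fin c.length), (∃ q, D.m ≤ (c.emb p q : ℕ)) →
      ‖blockIns (𝕜 := ℂ) H 0 (args45 D.n D.m zB czB) c p‖ ≤
        Real.exp (-(D.δ₀ * D.distX)) * (D.B₃ * ∏ q, ‖args45 D.n D.m zB czB (c.emb p q)‖)) :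
    Ineq45Printed D := by
  have h := norm_iteratedFDeriv_comp_le hU hα hball hf hS hB (Real.exp_nonneg _)
    (Real.exp_le_one_iff.2 (by linarith)) hH hH0 (args45 D.n D.m zB czB) (fun i => D.m ≤ (i : ℕ))
    ⟨D.m, D.m_lt_n⟩ le_rfl hv hvloc
  rw [prod_norm_args45 D.m_lt_n.le, ← hz, ← hcz, ← hlhs] at h
  unfold Ineq45Printed
  refine h.trans (le_of_eq ?_)
  rw [one_div, ← div_eq_mul_inv]
  ring

end Bound

end Literature.MathematicalPhysics.QuantumFieldTheory.Balaban1983to89.B12Repr43
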